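import Mathlib.Analysis.InnerProductSpace.PiL2
import Mathlib.Data.List.GetD

/-!
# Spherical codes from WEIGHTED coordinate lists (exact Gram matrices over a real quadratic field)

Framing: lottery ticket; floor = certified bounds/negative ranges. Venture `PackingBounds` (cell
`pub-packcert`, seat `pub-packcert-recog`, T5-ATTAINED) — attained-side infrastructure.

`ListConfig.lean` / `ListConfigKeys.lean` realise a code from coordinate lists over a ring `R ⊆ ℝ`.  A code
that is only known through its exact GRAM matrix `G` over a real quadratic field `K` has coordinates over `K`
only if `G` is positive semidefinite under BOTH real embeddings of `K`, which fails for the recognition seat's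
`ℚ(√5)`/`ℚ(√3)`/`ℚ(√6)` codes (RECOG-TABLE §T5-ATTAINED-SWEEP (ii) (B′)).  An exact `L D Lᵀ` factorisation
always exists, though: `G = L D Lᵀ` with `L` over `K` and a diagonal `D = diag(w)` whose entries are positive
reals of `K` (not necessarily totally positive).  This file realises such data: a row `l` becomes the point
`wvec l = (ι q)^{-1/2} (ι(l_i) √(ι w_i))_i ∈ ℝⁿ`, so that `⟪wvec l, wvec l'⟫ = ι(Σ_i w_i l_i l'_i) / ι q`
(`inner_wvec`).  The Boolean programs `shapeW` (lengths, weighted self-products `= q`) and `keysW` (every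
weighted product of two distinct rows is one of the listed keys) are run by `decide`; with `ι` injective,
`ι q > 0`, `ι w_i ≥ 0`, `q` not a key and every key `≤ s · q` the conclusion is
`exists_code_weighted : ∃ C ⊆ ℝⁿ, |C| = |L|, unit norms, pairwise inner products ≤ s`.
-/

namespace Summit.Ventures.PackingBounds.Config.Weighted

open Finset WithLp

variable {R : Type*} [CommRing R] [DecidableEq R]

/-- Weighted dot product `Σ_i w_i a_i b_i` of two coordinate lists (truncating at the shortest list). -/
def dotW : List R → List R → List R → R
  | w :: W, a :: l, b :: l' => w * (a * b) + dotW W l l'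
  | _, _, _ => 0

/-- Shape check: the weight list has length `n`; every row has length `n` and weighted self-product `q`. -/
def shapeW (W : List R) (L : List (List R)) (n : ℕ) (q : R) : Bool :=
  (W.length == n) && L.all fun v => v.length == n && dotW W v v == q

/-- Key check for a chunk of rows: every weighted product of a checked row `v ∈ rows` with a member of
`L.erase v` is one of the keys `K`. -/
def keysW (W : List R) (L : List (List R)) (K : List R) (rows : List (List R)) : Bool :=
  rows.all fun v => ((L.erase v).map (dotW W v)).all fun x => K.elem x

/-- The point of `ℝⁿ` attached to a row: coordinates `(ι q)^{-1/2} ι(l_i) √(ι w_i)`. -/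
noncomputable def wvec (ι : R →+* ℝ) (n : ℕ) (q : R) (W : List R) (l : List R) :
    EuclideanSpace ℝ (Fin n) :=
  toLp 2 fun i => (Real.sqrt (ι q))⁻¹ * (ι (l.getD i 0) * Real.sqrt (ι (W.getD i 0)))

/-- The configuration attached to a list of rows. -/
noncomputable def wconfig (ι : R →+* ℝ) (n : ℕ) (q : R) (W : List R) (L : List (List R)) :
    Finset (EuclideanSpace ℝ (Fin n)) :=
  (L.map (wvec ι n q W)).toFinset

variable (ι : R →+* ℝ) (n : ℕ) (q : R) (W : List R)

omit [DecidableEq R] in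
/-- Coordinate sums of weighted products are the image of `dotW`. -/
theorem sum_getD3 (W l l' : List R) (hW : W.length = n) (hl : l.length = n) (hl' : l'.length = n) :
    ∑ i : Fin n, ι (W.getD i 0) * (ι (l.getD i 0) * ι (l'.getD i 0)) = ι (dotW W l l') := by
  induction n generalizing W l l' with
  | zero =>
    cases W with
    | nil =>
      cases l with
      | nil =>
        cases l' with
        | nil => simp [dotW]
        | cons _ _ => simp at hl'
      | cons _ _ => simp at hl
    | cons _ _ => simp at hW
  | succ m ih =>
    cases W with
    | nil => simp at hW
    | cons w Wt =>
      cases l with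
      | nil => simp at hl
      | cons a t =>
        cases l' with
        | nil => simp at hl'
        | cons b t' =>
          simp only [List.length_cons, Nat.add_right_cancel_iff] at hW hl hl'
          rw [Fin.sum_univ_succ]
          simp only [Fin.val_zero, List.getD_cons_zero, Fin.val_succ, List.getD_cons_succ, dotW,
            map_add, map_mul]
          rw [ih Wt t t' hW hl hl']

omit [DecidableEq R] in
/-- Inner products of attached points: `⟪wvec l, wvec l'⟫ = ι(dotW W l l') / ι q` (weights with `ι w_i ≥ 0`). -/
theorem inner_wvec (hq : 0 < ι q) (hW : W.length = n) (hWnn : ∀ w ∈ W, 0 ≤ ι w)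
    (l l' : List R) (hl : l.length = n) (hl' : l'.length = n) :
    inner ℝ (wvec ι n q W l) (wvec ι n q W l') = ι (dotW W l l') / ι q := by
  have hwi : ∀ i : Fin n, 0 ≤ ι (W.getD i 0) := fun i => by
    rw [List.getD_eq_getElem _ _ (by rw [hW]; exact i.2)]
    exact hWnn _ (List.getElem_mem _)
  rw [wvec, wvec, EuclideanSpace.inner_toLp_toLp, dotProduct]
  have hs : Real.sqrt (ι q) ^ 2 = ι q := Real.sq_sqrt hq.le
  simp only [star_trivial]
  calc ∑ i : Fin n, (Real.sqrt (ι q))⁻¹ * (ι (l'.getD i 0) * Real.sqrt (ι (W.getD i 0)))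
        * ((Real.sqrt (ι q))⁻¹ * (ι (l.getD i 0) * Real.sqrt (ι (W.getD i 0))))
      = (Real.sqrt (ι q))⁻¹ ^ 2 * ∑ i : Fin n, ι (W.getD i 0) * (ι (l.getD i 0) * ι (l'.getD i 0)) := by
        rw [Finset.mul_sum]
        refine Finset.sum_congr rfl fun i _ => ?_
        have hw : Real.sqrt (ι (W.getD i 0)) ^ 2 = ι (W.getD i 0) := Real.sq_sqrt (hwi i)
        linear_combination ((Real.sqrt (ι q))⁻¹ ^ 2 * (ι (l.getD i 0) * ι (l'.getD i 0))) * hw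
    _ = ι (dotW W l l') / ι q := by
        rw [sum_getD3 ι n W l l' hW hl hl', inv_pow, hs]; ring

omit [DecidableEq R] in
/-- A row with weighted self-product `q` gives a unit vector. -/
theorem norm_wvec (hq : 0 < ι q) (hW : W.length = n) (hWnn : ∀ w ∈ W, 0 ≤ ι w)
    (l : List R) (hl : l.length = n) (hll : dotW W l l = q) : ‖wvec ι n q W l‖ = 1 := by
  have h := inner_wvec ι n q W hq hW hWnn l l hl hl
  rw [hll, div_self hq.ne', real_inner_self_eq_norm_sq] at h
  nlinarith [norm_nonneg (wvec ι n q W l)]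

variable {ι n q W} {L rows : List (List R)} {K : List R}

/-- The shape check gives the weight length. -/
theorem wlength_of_shapeW (h : shapeW W L n q = true) : W.length = n := by
  simp only [shapeW, List.all_eq_true, Bool.and_eq_true, beq_iff_eq] at h
  exact h.1

/-- The shape check gives the row lengths. -/
theorem length_of_shapeW (h : shapeW W L n q = true) {l : List R} (hl : l ∈ L) : l.length = n := by
  simp only [shapeW, List.all_eq_true, Bool.and_eq_true, beq_iff_eq] at h
  exact (h.2 l hl).1

/-- The shape check gives the weighted self-products. -/
theorem dotW_self_of_shapeW (h : shapeW W L n q = true) {l : List R} (hl : l ∈ L) :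
    dotW W l l = q := by
  simp only [shapeW, List.all_eq_true, Bool.and_eq_true, beq_iff_eq] at h
  exact (h.2 l hl).2

omit [DecidableEq R] in
/-- Membership in the configuration. -/
theorem mem_wconfig {x : EuclideanSpace ℝ (Fin n)} :
    x ∈ wconfig ι n q W L ↔ ∃ l ∈ L, wvec ι n q W l = x := by
  simp [wconfig]

/-- Every point of the configuration is a unit vector. -/
theorem norm_eq_one (hq : 0 < ι q) (hWnn : ∀ w ∈ W, 0 ≤ ι w)
    (hS : shapeW W L n q = true) : ∀ x ∈ wconfig ι n q W L, ‖x‖ = 1 := by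
  intro x hx
  obtain ⟨l, hl, rfl⟩ := mem_wconfig.1 hx
  exact norm_wvec ι n q W hq (wlength_of_shapeW hS) hWnn l (length_of_shapeW hS hl)
    (dotW_self_of_shapeW hS hl)

/-- A checked row's weighted products with the members of `L.erase` are keys. -/
theorem dot_mem_of_keysW (hK : keysW W L K rows = true) {l l' : List R} (hl : l ∈ rows)
    (hl' : l' ∈ L.erase l) : dotW W l l' ∈ K := by
  simp only [keysW, List.all_eq_true, List.mem_map] at hK
  have h := hK l hl (dotW W l l') ⟨l', hl', rfl⟩
  simpa using h

/-- Weighted products of two distinct members of `L` are keys. -/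
theorem dot_mem_keys_of_ne (hK : keysW W L K L = true) {l l' : List R} (hl : l ∈ L) (hl' : l' ∈ L)
    (hne : l ≠ l') : dotW W l l' ∈ K :=
  dot_mem_of_keysW hK hl ((List.mem_erase_of_ne (Ne.symm hne)).2 hl')

/-- The checks imply that `L` has no duplicate rows (`q` is not a key). -/
theorem nodup_of_keysW (hS : shapeW W L n q = true) (hK : keysW W L K L = true) (hqK : q ∉ K) :
    L.Nodup := by
  rw [List.nodup_iff_count_le_one]
  intro a
  by_contra hlt
  push Not at hlt
  have ha : a ∈ L := List.count_pos_iff.1 (by omega)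
  have ha2 : a ∈ L.erase a := by
    rw [← List.count_pos_iff, List.count_erase_self]; omega
  have hkey := dot_mem_of_keysW hK ha ha2
  rw [dotW_self_of_shapeW hS ha] at hkey
  exact hqK hkey

/-- `wvec` is injective on `L`. -/
theorem wvec_injOn (hι : Function.Injective ι) (hq : 0 < ι q) (hWnn : ∀ w ∈ W, 0 ≤ ι w)
    (hS : shapeW W L n q = true) (hK : keysW W L K L = true) (hqK : q ∉ K) :
    ∀ l ∈ L, ∀ l' ∈ L, wvec ι n q W l = wvec ι n q W l' → l = l' := by
  intro l hl l' hl' he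
  by_contra hne
  have hk := dot_mem_keys_of_ne hK hl hl' hne
  have hin := inner_wvec ι n q W hq (wlength_of_shapeW hS) hWnn l l' (length_of_shapeW hS hl)
    (length_of_shapeW hS hl')
  rw [he, real_inner_self_eq_norm_sq,
    norm_wvec ι n q W hq (wlength_of_shapeW hS) hWnn l' (length_of_shapeW hS hl')
      (dotW_self_of_shapeW hS hl'), one_pow, eq_div_iff hq.ne', one_mul] at hin
  exact hqK (hι hin ▸ hk)

/-- The configuration has `|L|` points. -/
theorem card_eq (hι : Function.Injective ι) (hq : 0 < ι q) (hWnn : ∀ w ∈ W, 0 ≤ ι w)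
    (hS : shapeW W L n q = true) (hK : keysW W L K L = true) (hqK : q ∉ K) :
    (wconfig ι n q W L).card = L.length := by
  rw [wconfig, List.toFinset_card_of_nodup
    (((nodup_of_keysW hS hK hqK).map_on (wvec_injOn hι hq hWnn hS hK hqK))), List.length_map]

/-- Inner products of distinct points are `ι k / ι q` for a key `k`. -/
theorem inner_mem_keys (hq : 0 < ι q) (hWnn : ∀ w ∈ W, 0 ≤ ι w)
    (hS : shapeW W L n q = true) (hK : keysW W L K L = true) :
    ∀ x ∈ wconfig ι n q W L, ∀ y ∈ wconfig ι n q W L, x ≠ y →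
      ∃ k ∈ K, inner ℝ x y = ι k / ι q := by
  intro x hx y hy hxy
  obtain ⟨l, hl, rfl⟩ := mem_wconfig.1 hx
  obtain ⟨l', hl', rfl⟩ := mem_wconfig.1 hy
  have hne : l ≠ l' := fun h => hxy (by rw [h])
  exact ⟨dotW W l l', dot_mem_keys_of_ne hK hl hl' hne,
    inner_wvec ι n q W hq (wlength_of_shapeW hS) hWnn l l' (length_of_shapeW hS hl)
      (length_of_shapeW hS hl')⟩

/-- Pairwise inner products are at most `s` as soon as every key is. -/
theorem inner_le_keys (hq : 0 < ι q) (hWnn : ∀ w ∈ W, 0 ≤ ι w)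
    (hS : shapeW W L n q = true) (hK : keysW W L K L = true) (s : ℝ) (hs : ∀ k ∈ K, ι k / ι q ≤ s) :
    ∀ x ∈ wconfig ι n q W L, ∀ y ∈ wconfig ι n q W L, x ≠ y → inner ℝ x y ≤ s := by
  intro x hx y hy hxy
  obtain ⟨k, hk, he⟩ := inner_mem_keys hq hWnn hS hK x hx y hy hxy
  exact he ▸ hs k hk

/-- **Packaging.** Weighted coordinate data passing `shapeW` and `keysW W L K L`, with `ι` injective,
`ι q > 0`, nonnegative weights, `q ∉ K` and every key `≤ s` after normalisation, gives `|L|` unit vectors of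
`ℝⁿ` with pairwise inner products `≤ s`. -/
theorem exists_code_weighted (hι : Function.Injective ι) (hq : 0 < ι q)
    (hWnn : ∀ w ∈ W, 0 ≤ ι w) (hS : shapeW W L n q = true) (hK : keysW W L K L = true)
    (hqK : q ∉ K) (s : ℝ) (hs : ∀ k ∈ K, ι k / ι q ≤ s) :
    ∃ C : Finset (EuclideanSpace ℝ (Fin n)), C.card = L.length ∧
      (∀ x ∈ C, ‖x‖ = 1) ∧ ∀ x ∈ C, ∀ y ∈ C, x ≠ y → inner ℝ x y ≤ s :=
  ⟨wconfig ι n q W L, card_eq hι hq hWnn hS hK hqK, norm_eq_one hq hWnn hS,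
    inner_le_keys hq hWnn hS hK s hs⟩

end Summit.Ventures.PackingBounds.Config.Weighted
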